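import Mathlib
import HarnessLib
import Summits.Ventures.LatticeQCDFlow.Exactness.SpectralKernelMap

/-!
# Kernels ARE spectral flows: every conjugation-equivariant map of `U(n)` / `SU(n)` is the spectral kernel of a permutation-equivariant eigenvalue map

HONEST FRAMING: exact (Metropolis-corrected) sampling algorithms for lattice gauge theory;
figures of merit are autocorrelation/cost numbers at stated couplings and volumes; no
continuum-physics claim.

Venture `LatticeQCDFlow` (cell pub-lqcd), topic `Exactness`; FANOUT row 10 (`eng-equiv`, engine
`latflow.equiv`, `equiv/spectral.py`).  NEW WORK of the cell, the converse of
`SpectralKernelMap.exists_spectralKernel_unitaryGroup` / `…_specialUnitaryGroup`, over the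
tree's `UnitaryGroup{MaximalTorus,WeylGroup,ConjugacyClasses}.lean` (`Z(Δ(n)) = Δ(n)`,
`Z(SΔ(n)) = SΔ(n)`, `N(SΔ(n)) → S(n)` surjective); nothing is cited as a fact; no number; no
definition is introduced.  Printed counterpart, NAMED ONLY: Boyda et al., PRD 103 (2021) 074504,
§III ("In Appendix A, we prove that this intuition is exact: a kernel can generally be defined as
an invertible map that acts on the list of eigenvalues of the input matrix, is equivariant under
permutations of the eigenvalues, and leaves the eigenvectors unchanged") and App. A Prop. 1 —
here without the smoothness clauses: the algebraic content is an EQUIVALENCE, so restricting the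
engine's kernels to spectral flows loses nothing.

## Content (`n` any finite index type; `U(n) = Matrix.unitaryGroup n ℂ`, `SU(n) = Matrix.specialUnitaryGroup n ℂ`)

* `kernel_apply_diagonal_eq` — a conjugation-equivariant `h : U(n) → U(n)` sends `diag(d)` to
  the diagonal matrix of its own diagonal entries;
* **`exists_eigenvalueMap_of_kernel_unitaryGroup`** — for every `h : U(n) → U(n)` with
  `h (X P X⁻¹) = X (h P) X⁻¹` there is an eigenvalue map `f` that is PERMUTATION EQUIVARIANT,
  preserves unimodularity, and whose spectral recipe `h` follows on EVERY unitary
  diagonalisation: `P = V diag(d) V⋆ ⟹ h P = V diag(f d) V⋆` (take `f d` = the diagonal of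
  `h(diag d)` on unimodular `d`);
* `kernel_apply_mem_specialDiagonalTorus`, `kernel_apply_diagonal_eq_special` — the `SU(n)`
  torus statements (`Z(SΔ(n)) = SΔ(n)`);
* **`exists_eigenvalueMap_of_kernel_specialUnitaryGroup`** — the same for `h : SU(n) → SU(n)`
  equivariant under `SU(n)`-conjugation: an `f` permutation equivariant (Weyl group of `SU(n)`
  is still `S(n)`: monomial representatives of determinant one), preserving `|λ| = 1 ∧ ∏ λ = 1`,
  with `h P = V diag(f d) V⋆` for every diagonalisation with `V ∈ SU(n)`;
  `agree_unitary_of_agree_special` upgrades agreement on `SU(n)` frames to all `U(n)` frames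
  (correct the frame by `diag(1, …, det V̄, …, 1)`, which commutes with `diag(d)`) — the
  hypothesis shape of `SpectralCouplingGaugeEquivariance.isGaugeEquivariant_spectralCouplingLayer`.

NOT here: continuity / smoothness (Boyda's Prop. 1 is about diffeomorphisms); any number.
-/

namespace Summit.Ventures.LatticeQCDFlow.Exactness

open Matrix
open Literature.LinearAlgebra.Matrix
open Literature.MathematicalPhysics.QuantumLattice (diagonal_mem_unitaryGroup_iff
  diagonal_mem_specialUnitaryGroup_iff)

variable {n : Type*} [Fintype n] [DecidableEq n]

/-! ## `U(n)` -/

section UnitaryCase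

/-- A conjugation-equivariant map of `U(n)` sends `diag(d)` to the diagonal matrix of its own
diagonal entries (it lands in `Δ(n)`, `SpectralKernelMap.kernel_apply_mem_diagonalTorus`). -/
theorem kernel_apply_diagonal_eq {h : Matrix.unitaryGroup n ℂ → Matrix.unitaryGroup n ℂ}
    (hh : ∀ X P : Matrix.unitaryGroup n ℂ, h (X * P * X⁻¹) = X * h P * X⁻¹) {d : n → ℂ}
    (hd : ∀ i, ‖d i‖ = 1) :
    ((h ⟨diagonal d, (diagonal_mem_unitaryGroup_iff d).mpr hd⟩ : Matrix.unitaryGroup n ℂ) : Matrix n n ℂ) =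
      diagonal fun i =>
        ((h ⟨diagonal d, (diagonal_mem_unitaryGroup_iff d).mpr hd⟩ : Matrix.unitaryGroup n ℂ) :
          Matrix n n ℂ) i i := by
  obtain ⟨e, he⟩ := mem_diagonalTorus_iff.mp
    (kernel_apply_mem_diagonalTorus hh (t := ⟨diagonal d, (diagonal_mem_unitaryGroup_iff d).mpr hd⟩)
      ⟨d, rfl⟩)
  rw [he]
  simp only [diagonal_apply_eq]

/-- **Every kernel on `U(n)` is a spectral flow.**  If `h : U(n) → U(n)` satisfies
`h (X P X⁻¹) = X (h P) X⁻¹`, then there is an eigenvalue map `f : (n → ℂ) → (n → ℂ)` which is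
permutation equivariant, preserves unimodularity, and such that `h P = V diag(f d) V⋆` for EVERY
unitary diagonalisation `P = V diag(d) V⋆` — `h` is the spectral kernel of `f` in the sense of
`SpectralKernelMap.lean`. -/
theorem exists_eigenvalueMap_of_kernel_unitaryGroup
    {h : Matrix.unitaryGroup n ℂ → Matrix.unitaryGroup n ℂ}
    (hh : ∀ X P : Matrix.unitaryGroup n ℂ, h (X * P * X⁻¹) = X * h P * X⁻¹) :
    ∃ f : (n → ℂ) → (n → ℂ),
      (∀ (σ : Equiv.Perm n) (d : n → ℂ), f (fun k => d (σ k)) = fun k => f d (σ k)) ∧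
      (∀ d : n → ℂ, (∀ i, ‖d i‖ = 1) → ∀ i, ‖f d i‖ = 1) ∧
      ∀ (P : Matrix.unitaryGroup n ℂ) (V : Matrix n n ℂ) (d : n → ℂ), V ∈ Matrix.unitaryGroup n ℂ →
        (P : Matrix n n ℂ) = V * diagonal d * star V →
          ((h P : Matrix.unitaryGroup n ℂ) : Matrix n n ℂ) = V * diagonal (f d) * star V := by
  classical
  let f : (n → ℂ) → (n → ℂ) := fun d =>
    if hd : ∀ i, ‖d i‖ = 1 then
      fun i => ((h ⟨diagonal d, (diagonal_mem_unitaryGroup_iff d).mpr hd⟩ : Matrix.unitaryGroup n ℂ) :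
        Matrix n n ℂ) i i
    else d
  have hfd : ∀ (d : n → ℂ) (hd : ∀ i, ‖d i‖ = 1),
      ((h ⟨diagonal d, (diagonal_mem_unitaryGroup_iff d).mpr hd⟩ : Matrix.unitaryGroup n ℂ) :
        Matrix n n ℂ) = diagonal (f d) := by
    intro d hd
    have hf : f d = fun i => ((h ⟨diagonal d, (diagonal_mem_unitaryGroup_iff d).mpr hd⟩ :
        Matrix.unitaryGroup n ℂ) : Matrix n n ℂ) i i := by
      simp only [f, dif_pos hd]
    rw [hf]
    exact kernel_apply_diagonal_eq hh hd
  refine ⟨f, ?_, ?_, ?_⟩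
  · intro σ d
    by_cases hd : ∀ i, ‖d i‖ = 1
    · have hdσ : ∀ i, ‖(fun k => d (σ k)) i‖ = 1 := fun i => hd (σ i)
      obtain ⟨ht', hht'⟩ := kernel_restrict_perm_equivariant hh
        (t := ⟨diagonal d, (diagonal_mem_unitaryGroup_iff d).mpr hd⟩) (d := d) (e := f d) rfl
        (hfd d hd) σ
      have heq : permUnitary σ⁻¹ * (⟨diagonal d, (diagonal_mem_unitaryGroup_iff d).mpr hd⟩ :
            Matrix.unitaryGroup n ℂ) * (permUnitary σ⁻¹)⁻¹ =
          ⟨diagonal fun k => d (σ k), (diagonal_mem_unitaryGroup_iff _).mpr hdσ⟩ :=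
        Subtype.ext ht'
      rw [heq, hfd _ hdσ] at hht'
      exact diagonal_injective hht'
    · have hdσ : ¬∀ i, ‖(fun k => d (σ k)) i‖ = 1 :=
        fun h' => hd fun i => by simpa using h' (σ.symm i)
      simp only [f, dif_neg hd, dif_neg hdσ]
  · intro d hd i
    have hmem := (h ⟨diagonal d, (diagonal_mem_unitaryGroup_iff d).mpr hd⟩).2
    rw [hfd d hd] at hmem
    exact norm_eq_one_of_diagonal_mem_unitaryGroup hmem i
  · intro P V d hV hP
    have hd : ∀ i, ‖d i‖ = 1 := norm_eq_one_of_eq_conj_diagonal P.2 hV hP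
    have hPt : P = (⟨V, hV⟩ : Matrix.unitaryGroup n ℂ) *
        ⟨diagonal d, (diagonal_mem_unitaryGroup_iff d).mpr hd⟩ * (⟨V, hV⟩ : Matrix.unitaryGroup n ℂ)⁻¹ :=
      Subtype.ext (by
        rw [Matrix.UnitaryGroup.mul_val, Matrix.UnitaryGroup.mul_val, Matrix.UnitaryGroup.inv_val]
        exact hP)
    rw [hPt, hh, Matrix.UnitaryGroup.mul_val, Matrix.UnitaryGroup.mul_val, Matrix.UnitaryGroup.inv_val,
      hfd d hd]

end UnitaryCase

/-! ## `SU(n)` -/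

section SpecialCase

/-- **A conjugation-equivariant map of `SU(n)` maps the special diagonal torus to itself**
(`SΔ(n)` abelian, `Z(SΔ(n)) = SΔ(n)` — the tree's `mem_specialDiagonalTorus_of_forall_commute`). -/
theorem kernel_apply_mem_specialDiagonalTorus
    {h : Matrix.specialUnitaryGroup n ℂ → Matrix.specialUnitaryGroup n ℂ}
    (hh : ∀ X P : Matrix.specialUnitaryGroup n ℂ, h (X * P * X⁻¹) = X * h P * X⁻¹)
    {t : Matrix.specialUnitaryGroup n ℂ} (ht : t ∈ specialDiagonalTorus n) :
    h t ∈ specialDiagonalTorus n := by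
  refine mem_specialDiagonalTorus_of_forall_commute fun s hs => ?_
  have hst : s * t * s⁻¹ = t := by
    rw [mul_comm_of_mem_specialDiagonalTorus hs ht, mul_inv_cancel_right]
  have key := hh s t
  rw [hst] at key
  calc s * h t = s * h t * s⁻¹ * s := by rw [inv_mul_cancel_right]
    _ = h t * s := by rw [← key]

/-- A conjugation-equivariant map of `SU(n)` sends `diag(d)` to the diagonal matrix of its own
diagonal entries. -/
theorem kernel_apply_diagonal_eq_special
    {h : Matrix.specialUnitaryGroup n ℂ → Matrix.specialUnitaryGroup n ℂ}
    (hh : ∀ X P : Matrix.specialUnitaryGroup n ℂ, h (X * P * X⁻¹) = X * h P * X⁻¹) {d : n → ℂ}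
    (hd : (∀ i, ‖d i‖ = 1) ∧ ∏ i, d i = 1) :
    ((h ⟨diagonal d, (diagonal_mem_specialUnitaryGroup_iff d).mpr hd⟩ : Matrix.specialUnitaryGroup n ℂ) :
        Matrix n n ℂ) =
      diagonal fun i =>
        ((h ⟨diagonal d, (diagonal_mem_specialUnitaryGroup_iff d).mpr hd⟩ :
          Matrix.specialUnitaryGroup n ℂ) : Matrix n n ℂ) i i := by
  obtain ⟨e, he⟩ := mem_specialDiagonalTorus_iff.mp
    (kernel_apply_mem_specialDiagonalTorus hh
      (t := ⟨diagonal d, (diagonal_mem_specialUnitaryGroup_iff d).mpr hd⟩) ⟨d, rfl⟩)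
  rw [he]
  simp only [diagonal_apply_eq]

/-- **Every kernel on `SU(n)` is a spectral flow.**  If `h : SU(n) → SU(n)` satisfies
`h (X P X⁻¹) = X (h P) X⁻¹` for `X ∈ SU(n)`, then there is a permutation-equivariant eigenvalue
map `f` preserving `|λ| = 1 ∧ ∏ λ = 1` with `h P = V diag(f d) V⋆` for every diagonalisation
`P = V diag(d) V⋆` with `V ∈ SU(n)`. -/
theorem exists_eigenvalueMap_of_kernel_specialUnitaryGroup
    {h : Matrix.specialUnitaryGroup n ℂ → Matrix.specialUnitaryGroup n ℂ}
    (hh : ∀ X P : Matrix.specialUnitaryGroup n ℂ, h (X * P * X⁻¹) = X * h P * X⁻¹) :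
    ∃ f : (n → ℂ) → (n → ℂ),
      (∀ (σ : Equiv.Perm n) (d : n → ℂ), f (fun k => d (σ k)) = fun k => f d (σ k)) ∧
      (∀ d : n → ℂ, (∀ i, ‖d i‖ = 1) → ∏ i, d i = 1 → (∀ i, ‖f d i‖ = 1) ∧ ∏ i, f d i = 1) ∧
      ∀ (P : Matrix.specialUnitaryGroup n ℂ) (V : Matrix n n ℂ) (d : n → ℂ),
        V ∈ Matrix.specialUnitaryGroup n ℂ → (P : Matrix n n ℂ) = V * diagonal d * star V →
          ((h P : Matrix.specialUnitaryGroup n ℂ) : Matrix n n ℂ) = V * diagonal (f d) * star V := by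
  classical
  let f : (n → ℂ) → (n → ℂ) := fun d =>
    if hd : (∀ i, ‖d i‖ = 1) ∧ ∏ i, d i = 1 then
      fun i => ((h ⟨diagonal d, (diagonal_mem_specialUnitaryGroup_iff d).mpr hd⟩ :
        Matrix.specialUnitaryGroup n ℂ) : Matrix n n ℂ) i i
    else d
  have hfd : ∀ (d : n → ℂ) (hd : (∀ i, ‖d i‖ = 1) ∧ ∏ i, d i = 1),
      ((h ⟨diagonal d, (diagonal_mem_specialUnitaryGroup_iff d).mpr hd⟩ : Matrix.specialUnitaryGroup n ℂ) :
        Matrix n n ℂ) = diagonal (f d) := by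
    intro d hd
    have hf : f d = fun i => ((h ⟨diagonal d, (diagonal_mem_specialUnitaryGroup_iff d).mpr hd⟩ :
        Matrix.specialUnitaryGroup n ℂ) : Matrix n n ℂ) i i := by
      simp only [f, dif_pos hd]
    rw [hf]
    exact kernel_apply_diagonal_eq_special hh hd
  have hcond : ∀ (σ : Equiv.Perm n) (d : n → ℂ),
      ((∀ i, ‖(fun k => d (σ k)) i‖ = 1) ∧ ∏ i, (fun k => d (σ k)) i = 1) ↔
        ((∀ i, ‖d i‖ = 1) ∧ ∏ i, d i = 1) := by
    intro σ d
    rw [Equiv.prod_comp σ d]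
    exact and_congr_left fun _ =>
      ⟨fun h' i => by simpa using h' (σ.symm i), fun h' i => h' (σ i)⟩
  refine ⟨f, ?_, ?_, ?_⟩
  · intro σ d
    by_cases hd : (∀ i, ‖d i‖ = 1) ∧ ∏ i, d i = 1
    · have hdσ : (∀ i, ‖(fun k => d (σ k)) i‖ = 1) ∧ ∏ i, (fun k => d (σ k)) i = 1 := (hcond σ d).mpr hd
      -- a representative of `σ` in `N(SΔ(n))`
      obtain ⟨g, hg⟩ := specialNormalizerToPerm_surjective (n := n) σ⁻¹
      set t : Matrix.specialUnitaryGroup n ℂ := ⟨diagonal d, (diagonal_mem_specialUnitaryGroup_iff d).mpr hd⟩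
        with ht
      have ht' : (((g : Matrix.specialUnitaryGroup n ℂ) * t * (g : Matrix.specialUnitaryGroup n ℂ)⁻¹ :
          Matrix.specialUnitaryGroup n ℂ) : Matrix n n ℂ) = diagonal fun k => d (σ k) := by
        rw [coe_conj_eq_diagonal_special g (t := t) rfl, hg, inv_inv]
      have hht' : ((h ((g : Matrix.specialUnitaryGroup n ℂ) * t * (g : Matrix.specialUnitaryGroup n ℂ)⁻¹) :
          Matrix.specialUnitaryGroup n ℂ) : Matrix n n ℂ) = diagonal fun k => f d (σ k) := by
        rw [hh, coe_conj_eq_diagonal_special g (t := h t) (hfd d hd), hg, inv_inv]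
      have heq : (g : Matrix.specialUnitaryGroup n ℂ) * t * (g : Matrix.specialUnitaryGroup n ℂ)⁻¹ =
          ⟨diagonal fun k => d (σ k), (diagonal_mem_specialUnitaryGroup_iff _).mpr hdσ⟩ :=
        Subtype.ext ht'
      rw [heq, hfd _ hdσ] at hht'
      exact diagonal_injective hht'
    · have hdσ : ¬((∀ i, ‖(fun k => d (σ k)) i‖ = 1) ∧ ∏ i, (fun k => d (σ k)) i = 1) :=
        fun h' => hd ((hcond σ d).mp h')
      simp only [f, dif_neg hd, dif_neg hdσ]
  · intro d hd1 hd2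
    have hmem := (h ⟨diagonal d, (diagonal_mem_specialUnitaryGroup_iff d).mpr ⟨hd1, hd2⟩⟩).2
    rw [hfd d ⟨hd1, hd2⟩] at hmem
    exact (diagonal_mem_specialUnitaryGroup_iff _).mp hmem
  · intro P V d hV hP
    have hVu : V ∈ Matrix.unitaryGroup n ℂ := (Matrix.mem_specialUnitaryGroup_iff.mp hV).1
    have hd : (∀ i, ‖d i‖ = 1) ∧ ∏ i, d i = 1 :=
      ⟨norm_eq_one_of_eq_conj_diagonal (Matrix.mem_specialUnitaryGroup_iff.mp P.2).1 hVu hP,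
        prod_eq_one_of_eq_conj_diagonal P.2 hVu hP⟩
    have hmul : ∀ A B : Matrix.specialUnitaryGroup n ℂ,
        ((A * B : Matrix.specialUnitaryGroup n ℂ) : Matrix n n ℂ) = (A : Matrix n n ℂ) * (B : Matrix n n ℂ) :=
      fun _ _ => rfl
    have hinv : ∀ A : Matrix.specialUnitaryGroup n ℂ,
        ((A⁻¹ : Matrix.specialUnitaryGroup n ℂ) : Matrix n n ℂ) = star (A : Matrix n n ℂ) :=
      fun _ => rfl
    have hPt : P = (⟨V, hV⟩ : Matrix.specialUnitaryGroup n ℂ) *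
        ⟨diagonal d, (diagonal_mem_specialUnitaryGroup_iff d).mpr hd⟩ *
          (⟨V, hV⟩ : Matrix.specialUnitaryGroup n ℂ)⁻¹ :=
      Subtype.ext (by rw [hmul, hmul, hinv]; exact hP)
    rw [hPt, hh, hmul, hmul, hinv, hfd d hd]

/-- **Agreement on `SU(n)` frames gives agreement on all `U(n)` frames.**  If `h P = V diag(f d) V⋆`
for every diagonalisation with `V ∈ SU(n)`, then also for every `V ∈ U(n)`: correct `V` by the
diagonal unitary `diag(1, …, det V̄, …, 1)`, which commutes with `diag(d)` and `diag(f d)`. -/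
theorem agree_unitary_of_agree_special {f : (n → ℂ) → (n → ℂ)}
    {h : Matrix.specialUnitaryGroup n ℂ → Matrix.specialUnitaryGroup n ℂ}
    (hagree : ∀ (P : Matrix.specialUnitaryGroup n ℂ) (V : Matrix n n ℂ) (d : n → ℂ),
      V ∈ Matrix.specialUnitaryGroup n ℂ → (P : Matrix n n ℂ) = V * diagonal d * star V →
        ((h P : Matrix.specialUnitaryGroup n ℂ) : Matrix n n ℂ) = V * diagonal (f d) * star V)
    (P : Matrix.specialUnitaryGroup n ℂ) (V : Matrix n n ℂ) (d : n → ℂ)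
    (hV : V ∈ Matrix.unitaryGroup n ℂ) (hP : (P : Matrix n n ℂ) = V * diagonal d * star V) :
    ((h P : Matrix.specialUnitaryGroup n ℂ) : Matrix n n ℂ) = V * diagonal (f d) * star V := by
  rcases isEmpty_or_nonempty n with hn | ⟨⟨i₀⟩⟩
  · ext i j
    exact isEmptyElim i
  -- `c = det V` is unimodular; correct `V` by `diag(1, …, c̄, …, 1)`
  set c : ℂ := V.det with hc
  have hc1 : ‖c‖ = 1 := CStarRing.norm_of_mem_unitary (Matrix.det_of_mem_unitary hV)
  have hcc : c * (starRingEnd ℂ) c = 1 := by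
    rw [Complex.mul_conj, Complex.normSq_eq_norm_sq, hc1, one_pow, Complex.ofReal_one]
  set s : n → ℂ := Function.update (fun _ => 1) i₀ ((starRingEnd ℂ) c) with hs
  have hs1 : ∀ i, ‖s i‖ = 1 := by
    intro i
    rcases eq_or_ne i i₀ with rfl | hi
    · rw [hs, Function.update_self, RCLike.norm_conj, hc1]
    · rw [hs, Function.update_of_ne hi, norm_one]
  have hss : ∀ i, s i * star (s i) = 1 := fun i => by
    rw [Complex.star_def, Complex.mul_conj, Complex.normSq_eq_norm_sq, hs1, one_pow, Complex.ofReal_one]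
  have hS : diagonal s ∈ Matrix.unitaryGroup n ℂ := (diagonal_mem_unitaryGroup_iff s).mpr hs1
  have hdetS : (diagonal s).det = (starRingEnd ℂ) c := by
    rw [det_diagonal, hs, Finset.prod_update_of_mem (Finset.mem_univ _), Finset.prod_const_one, mul_one]
  have hV1 : V * diagonal s ∈ Matrix.specialUnitaryGroup n ℂ :=
    Matrix.mem_specialUnitaryGroup_iff.mpr ⟨Submonoid.mul_mem _ hV hS, by rw [det_mul, hdetS, ← hc, hcc]⟩
  -- the corrected frame diagonalises the same way, for any diagonal middle factor
  have hconj : ∀ e : n → ℂ, V * diagonal s * diagonal e * star (V * diagonal s) = V * diagonal e * star V := by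
    intro e
    rw [star_mul, star_eq_conjTranspose (diagonal s), diagonal_conjTranspose]
    have hmid : diagonal s * diagonal e * diagonal (star s) = diagonal e := by
      rw [diagonal_mul_diagonal, diagonal_mul_diagonal]
      congr 1
      funext i
      rw [mul_right_comm, Pi.star_apply, hss i, one_mul]
    calc V * diagonal s * diagonal e * (diagonal (star s) * star V)
          = V * (diagonal s * diagonal e * diagonal (star s)) * star V := by simp only [Matrix.mul_assoc]
      _ = V * diagonal e * star V := by rw [hmid]
  rw [← hconj (f d)]
  exact hagree P (V * diagonal s) d hV1 (by rw [hconj d]; exact hP)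

end SpecialCase

end Summit.Ventures.LatticeQCDFlow.Exactness
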